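import Summits.Ventures.HodgeRepro2.T5FinitePlaceBinaryUniversal

/-!
# `(U)` on the route's `E_w` at every INERT place — the dyadic inert places included
(cell pub-hodge-repro2, seat p3)

Tier-5 N2 support, rows N2.2.2 / N2.8.1 of route/T5-N2-route-3.md. File 143 proved `(U) = BinaryUniversal E_w`
at the non-dyadic non-split places from `IndexTwo E_w` (file 141) and `(U′)` (file 142). File 142's inert case
`isSumTwoNorms_of_irreducible` needs NO hypothesis on the residue characteristic (seat p4's description
`N = {y | log v y even}` holds at every inert place), so `(U)` also holds at the inert places above `2`:

* `binaryUniversal_of_forall_isSumTwoNorms`: the index-two case analysis of file 143 with `(U′)` as a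
  hypothesis — `(U)` follows from `IndexTwo E_w` and «every unit of `F_v` is a sum of two norms»;
* **`binaryUniversal_of_irreducible`**: `(U)` at every inert place (`ϖ` irreducible in `O_{F_v}` stays
  irreducible in `O_{E_w}`), any residue characteristic;
* the corollaries there with NO binder: `isCongruent_iff_exists_det_eq_local_of_irreducible` (Shimura Lemma 1.6),
  `isCongruent_iff_hilbertSolvable_local_of_irreducible` (row N2.8.1 (i)),
  `exists_two_classes_local_of_irreducible` (HKS96's two classes).

With file 143, `(U)` stays a binder ONLY at the places `v ∣ 2` of `F` that RAMIFY in `E` (wild quadratic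
extensions — Jacobowitz 1962 / O'Meara 63:19 in the dyadic case). For a CM field in which `2` is inert or split
(e.g. `ℚ(ζ₇)`: `2` splits in `ℚ(ζ₇)/ℚ(ζ₇)⁺`; `ℚ(ζ₉)`: `2` is inert) no place is left out. Mathlib + this seat's
files 141–143 only; no display; no device. §8(d): uses an L-value-free non-vanishing device: NO.
-/

namespace Summit.Ventures.HodgeRepro2.T5FinitePlaceBinaryUniversalInert

open IsDedekindDomain IsDedekindDomain.HeightOneSpectrum NumberField Module
open Summit.Ventures.HodgeRepro2.T5FinitePlaceTensorEquiv Summit.Ventures.HodgeRepro2.T5FinitePlaceStar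
  Summit.Ventures.HodgeRepro2.T5FinitePlaceIsometryCriterion Summit.Ventures.HodgeRepro2.T5HilbertSymbolNorm
  Summit.Ventures.HodgeRepro2.T5HermitianDetClass Summit.Ventures.HodgeRepro2.T5HermitianClassify
  Summit.Ventures.HodgeRepro2.T5HermitianTwoClasses Summit.Ventures.HodgeRepro2.T5AdicCompletionNormGroup
  Summit.Ventures.HodgeRepro2.T5LocalNormIndex Summit.Ventures.HodgeRepro2.T5FinitePlaceNormIndex
  Summit.Ventures.HodgeRepro2.T5FinitePlaceSumTwoNorms

/-! As in files 141 and 143, the namespace `T5FinitePlaceLiesOver` is not opened: `algebraMap (v.adicCompletion F)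
(w.adicCompletion E)` is seat p4's global instance throughout. -/

section Inert

variable {F E : Type*} [Field F] [NumberField F] [Field E] [NumberField E] [Algebra F E]
  [Algebra.IsQuadraticExtension F E]
variable (v : HeightOneSpectrum (𝓞 F)) (w : HeightOneSpectrum (𝓞 E)) [w.asIdeal.LiesOver v.asIdeal]
variable {s : E} {θ : F}
variable (hs : s ^ 2 = algebraMap F E θ) (hspan : Submodule.span F {(1 : E), s} = ⊤)
  (hsq : ¬ IsSquare (algebraMap F (v.adicCompletion F) θ)) (c : E ≃ₐ[F] E) (hc : c s = -s)

/-- **`(U)` from `IndexTwo E_w` and `(U′)`:** the index-two case analysis of file 143 with «every unit of `F_v`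
is a sum of two norms» as a hypothesis. -/
theorem binaryUniversal_of_forall_isSumTwoNorms
    (hsum : ∀ y : (v.adicCompletion F)ˣ, IsSumTwoNorms v w (localConj v w hs hspan hsq c) y) :
    letI := localStarRing v w hs hspan hsq c hc
    BinaryUniversal (w.adicCompletion E) := by
  letI := localStarRing v w hs hspan hsq c hc
  have h2 := finrank_eq_two' v w hs hspan hsq
  have hσ := localConj_ne_one v w hs hspan hsq c hc
  have hidx := index_normGroup_eq_two v w (localConj v w hs hspan hsq c) h2 hσ
  intro a b c₀ ha hb hc₀ ha0 hb0 hc₀0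
  obtain ⟨ya, rfl⟩ := exists_algebraMap_eq_of_star_eq_self v w hs hspan hsq c hc ha
  obtain ⟨yb, rfl⟩ := exists_algebraMap_eq_of_star_eq_self v w hs hspan hsq c hc hb
  obtain ⟨yc, rfl⟩ := exists_algebraMap_eq_of_star_eq_self v w hs hspan hsq c hc hc₀
  have hya : ya ≠ 0 := fun h => ha0 (by rw [h, map_zero])
  have hyb : yb ≠ 0 := fun h => hb0 (by rw [h, map_zero])
  have hyc : yc ≠ 0 := fun h => hc₀0 (by rw [h, map_zero])
  have hP : algebraMap (v.adicCompletion F) (w.adicCompletion E) ya ≠ 0 := (map_ne_zero _).2 hya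
  -- Case 1: `c/a` is a norm
  by_cases h1 : Units.mk0 yc hyc * (Units.mk0 ya hya)⁻¹ ∈ normGroup v w (localConj v w hs hspan hsq c)
  · obtain ⟨x, hx⟩ := h1
    refine ⟨x, 0, ?_⟩
    rw [star_zero, zero_mul, zero_mul, add_zero, ← localConj_eq_star v w hs hspan hsq c hc,
      mul_comm (localConj v w hs hspan hsq c x) x, hx, ← map_mul, Units.val_mul, Units.val_inv_eq_inv_val,
      Units.val_mk0, Units.val_mk0, inv_mul_cancel_right₀ hya]
  -- Case 2: `c/b` is a norm
  by_cases h2' : Units.mk0 yc hyc * (Units.mk0 yb hyb)⁻¹ ∈ normGroup v w (localConj v w hs hspan hsq c)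
  · obtain ⟨y, hy⟩ := h2'
    refine ⟨0, y, ?_⟩
    rw [star_zero, zero_mul, zero_mul, zero_add, ← localConj_eq_star v w hs hspan hsq c hc,
      mul_comm (localConj v w hs hspan hsq c y) y, hy, ← map_mul, Units.val_mul, Units.val_inv_eq_inv_val,
      Units.val_mk0, Units.val_mk0, inv_mul_cancel_right₀ hyb]
  -- Case 3: neither is a norm, so `b/a = (c/a) · (c/b)⁻¹` is a norm
  have h3 : Units.mk0 yb hyb * (Units.mk0 ya hya)⁻¹ ∈ normGroup v w (localConj v w hs hspan hsq c) := by
    have hmem := (Subgroup.mul_mem_iff_of_index_two hidx).2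
      (iff_of_false h1 fun h => h2' (Subgroup.inv_mem_iff _ |>.1 h))
    have e : Units.mk0 yc hyc * (Units.mk0 ya hya)⁻¹ * (Units.mk0 yc hyc * (Units.mk0 yb hyb)⁻¹)⁻¹ =
        Units.mk0 yb hyb * (Units.mk0 ya hya)⁻¹ := by
      apply Units.ext
      simp only [Units.val_mul, Units.val_inv_eq_inv_val, Units.val_mk0, mul_inv_rev, inv_inv]
      field_simp
    rwa [e] at hmem
  obtain ⟨x₁, x₂, hx⟩ := hsum (Units.mk0 yc hyc * (Units.mk0 ya hya)⁻¹)
  obtain ⟨z, hz⟩ := h3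
  have hz0 : z ≠ 0 := by
    rintro rfl
    rw [zero_mul, eq_comm, map_eq_zero] at hz
    exact (Units.mk0 yb hyb * (Units.mk0 ya hya)⁻¹).ne_zero hz
  have hσz : localConj v w hs hspan hsq c z ≠ 0 := (map_ne_zero _).2 hz0
  have hx' : (x₁ * localConj v w hs hspan hsq c x₁ + x₂ * localConj v w hs hspan hsq c x₂) *
      algebraMap (v.adicCompletion F) (w.adicCompletion E) ya =
        algebraMap (v.adicCompletion F) (w.adicCompletion E) yc := by
    rw [hx, Units.val_mul, Units.val_inv_eq_inv_val, Units.val_mk0, Units.val_mk0, map_mul, map_inv₀,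
      inv_mul_cancel_right₀ hP]
  have hz' : (z * localConj v w hs hspan hsq c z) * algebraMap (v.adicCompletion F) (w.adicCompletion E) ya =
      algebraMap (v.adicCompletion F) (w.adicCompletion E) yb := by
    rw [hz, Units.val_mul, Units.val_inv_eq_inv_val, Units.val_mk0, Units.val_mk0, map_mul, map_inv₀,
      inv_mul_cancel_right₀ hP]
  refine ⟨x₁, x₂ / z, ?_⟩
  rw [← localConj_eq_star v w hs hspan hsq c hc, ← localConj_eq_star v w hs hspan hsq c hc, map_div₀, ← hz',
    ← hx']
  field_simp

variable {ϖ : adicCompletionIntegers F v} (hϖ : Irreducible ϖ)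
  (hϖS : Irreducible (algebraMap (adicCompletionIntegers F v) (adicCompletionIntegers E w) ϖ))

include hϖ hϖS in
/-- **`(U)` on `E_w` at every INERT place** (a uniformiser of `F_v` stays irreducible in `O_{E_w}`), any residue
characteristic — file 142's `isSumTwoNorms_of_irreducible` needs no hypothesis on `2`. -/
theorem binaryUniversal_of_irreducible :
    letI := localStarRing v w hs hspan hsq c hc
    BinaryUniversal (w.adicCompletion E) :=
  binaryUniversal_of_forall_isSumTwoNorms v w hs hspan hsq c hc fun y =>
    isSumTwoNorms_of_irreducible v w (localConj v w hs hspan hsq c) (finrank_eq_two' v w hs hspan hsq)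
      (localConj_ne_one v w hs hspan hsq c hc) hϖ hϖS y

include hϖ hϖS in
/-- Shimura's Lemma 1.6 on `E_w`, unconditional at every inert place. -/
theorem isCongruent_iff_exists_det_eq_local_of_irreducible {ι : Type*} [Fintype ι] [DecidableEq ι]
    {H H' : Matrix ι ι (w.adicCompletion E)}
    (hH : letI := localStarRing v w hs hspan hsq c hc; H.IsHermitian)
    (hH' : letI := localStarRing v w hs hspan hsq c hc; H'.IsHermitian) (hdet : IsUnit H.det) :
    letI := localStarRing v w hs hspan hsq c hc
    IsCongruent H H' ↔ ∃ u : w.adicCompletion E, u ≠ 0 ∧ H'.det = star u * u * H.det := by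
  letI := localStarRing v w hs hspan hsq c hc
  exact isCongruent_iff_exists_det_eq (exists_add_star_ne_zero_local v w hs hspan hsq c hc)
    (binaryUniversal_of_irreducible v w hs hspan hsq c hc hϖ hϖS) hH hH' hdet

include hϖ hϖS in
/-- Row N2.8.1 (i) on the route's completions, unconditional at every inert place: Gram matrices over `E_w`
with `det H' = a · det H`, `a ∈ F_v^×`, are congruent iff `(a, θ)_v = 1`. -/
theorem isCongruent_iff_hilbertSolvable_local_of_irreducible {ι : Type*} [Fintype ι] [DecidableEq ι]
    {H H' : Matrix ι ι (w.adicCompletion E)}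
    (hH : letI := localStarRing v w hs hspan hsq c hc; H.IsHermitian)
    (hH' : letI := localStarRing v w hs hspan hsq c hc; H'.IsHermitian) (hdet : IsUnit H.det)
    {a : v.adicCompletion F} (ha : a ≠ 0)
    (hdet' : H'.det = algebraMap (v.adicCompletion F) (w.adicCompletion E) a * H.det) :
    letI := localStarRing v w hs hspan hsq c hc
    IsCongruent H H' ↔ HilbertSolvable a (algebraMap F (v.adicCompletion F) θ) := by
  letI := localStarRing v w hs hspan hsq c hc
  have hdet'' : H'.det = T5FinitePlaceLiesOver.completionMap F E v w a * H.det := by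
    rw [hdet', algebraMap_apply']
  exact isCongruent_iff_hilbertSolvable v w hs hspan hsq c hc
    (binaryUniversal_of_irreducible v w hs hspan hsq c hc hϖ hϖS) hH hH' hdet ha hdet''

include hϖ hϖS in
/-- HKS96's «precisely two isomorphism classes in each dimension» on `E_w`, unconditional at every inert
place. -/
theorem exists_two_classes_local_of_irreducible (m : ℕ) :
    letI := localStarRing v w hs hspan hsq c hc
    ∃ H₁ H₂ : Matrix (Fin (m + 1)) (Fin (m + 1)) (w.adicCompletion E),
      H₁.IsHermitian ∧ H₂.IsHermitian ∧ IsUnit H₁.det ∧ IsUnit H₂.det ∧ ¬ IsCongruent H₁ H₂ ∧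
        ∀ H : Matrix (Fin (m + 1)) (Fin (m + 1)) (w.adicCompletion E), H.IsHermitian → IsUnit H.det →
          IsCongruent H H₁ ∨ IsCongruent H H₂ := by
  letI := localStarRing v w hs hspan hsq c hc
  exact exists_two_classes_local v w hs hspan hsq c hc
    (binaryUniversal_of_irreducible v w hs hspan hsq c hc hϖ hϖS) m

end Inert

end Summit.Ventures.HodgeRepro2.T5FinitePlaceBinaryUniversalInert
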